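import Summits.Schanuel.Schanuel.Theorems.ZilberEacPowerCurveConstFibre
import Summits.Schanuel.Schanuel.Theorems.ZilberEacParamRamifiedChart
import HarnessLib

/-!
# Arbitrary base branches, XXII: constant fibres over the SUPERELLIPTIC curves `x₁^k = P(x₀)`
# (`P` monic with a simple root) are in Mantova–Masser's case AND dense, off one residue class

HONEST FRAMING.  Cell `pub-schanuel` (Zilber's Exponential-Algebraic Closedness, case ladder;
host summit Schanuel), seat 2, gen 28.  Files XX (`P = x₀^M + 1`) and XXI (`k = 2`, `P` cubic) are
joined: for `k ≥ 2` and a MONIC `P ∈ ℂ[x₀]` of degree `M ≥ 1` with a simple root `r`, the curve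
`C : x₁^k = P(x₀)` is irreducible (Eisenstein at `(x₀ − r)`), and at `x₀ = ∞` it has the branch
`x₀ = s^{-k}`, `x₁ = U₀(s)^{1/k}s^{-M}` where `P(s^{-k}) = U₀(s)s^{-kM}`, `U₀(0) = 1` (the reversed
polynomial, `exists_polarForm_eval` of gen 27): label order `k`, second order `M`, direction `1`.
Off the residue class `k ∣ 2M ∧ 2M/k ≡ 2 (mod 4)` a good `k`-th root of `2πi` exists (file XX) and
one good direction suffices (file XIX); the case certificate uses the `μ_k`-action `x₁ ↦ ωx₁`
(all points on a line would force `P ≡ 0`).  Hence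
**`unprojectedDensityQuestion_superelliptic_constFibre`**: `{x₁^k − P(x₀) = 0, y₀ = θ}` is in the
case AND dense for every such `(k, P)` and every `θ ≠ 0` — every hyperelliptic curve
`x₁² = P(x₀)` with `deg P ≢ 2 (mod 4)` (so all odd degrees: every genus), every cyclic cover
`x₁^k = P(x₀)` with `k ∤ 2 deg P`, etc.  Decided instances of an OPEN question (Mantova–Masser,
PLMS 2024 §1 p. 5); the residue class stays OPEN; EC(3,2) OPEN; NOT Schanuel's conjecture (neither
used nor implied); EAC ⇏ SC.
-/

noncomputable section

open Filter Topology Set Complex MvPolynomial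
open Literature.NumberTheory.Transcendental Literature.ModelTheory.Zilber
open Literature.ModelTheory.ExponentialFields

set_option linter.dupNamespace false

namespace Summit.Schanuel.Schanuel.Theorems

section Superelliptic

variable (P : Polynomial ℂ)

/-! ## Part A. `x₁^k − P(x₀)` is irreducible when `P` has a simple root (Eisenstein) -/

/-- `(X − r)² ∤ P` when `P′(r) ≠ 0`. [folklore] -/
theorem X_sub_C_sq_not_dvd_of_deriv_ne_zero {r : ℂ} (hr1 : P.derivative.eval r ≠ 0) :
    ¬ (Polynomial.X - Polynomial.C r) ^ 2 ∣ P := by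
  rintro ⟨q, hq⟩
  have hd := congrArg (fun p : Polynomial ℂ => (Polynomial.derivative p).eval r) hq
  simp only [Polynomial.derivative_mul, Polynomial.derivative_pow, Polynomial.derivative_sub,
    Polynomial.derivative_X, Polynomial.derivative_C, sub_zero, mul_one, Polynomial.eval_add,
    Polynomial.eval_mul, Polynomial.eval_pow, Polynomial.eval_sub, Polynomial.eval_X,
    Polynomial.eval_C, sub_self, Nat.cast_ofNat] at hd
  norm_num at hd
  exact hr1 hd

/-- `t^k − P(s)` is irreducible in `ℂ[s][t]` when `k ≥ 1` and `P` has a simple root `r`: Eisenstein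
at `(s − r)` — the cyclic-cover lemma `irreducible_X_pow_sub_C` of
`Literature.ModelTheory.Zilber.EACCyclicCoverBases`. [folklore] -/
theorem irreducible_superelliptic_row {k : ℕ} (hk : 1 ≤ k) {r : ℂ} (hr : P.IsRoot r)
    (hr1 : P.derivative.eval r ≠ 0) :
    Irreducible (Polynomial.X ^ k + Polynomial.C (-P)) := by
  have h := irreducible_X_pow_sub_C (by omega : 0 < k) (Polynomial.prime_X_sub_C r)
    (Polynomial.dvd_iff_isRoot.2 hr) (X_sub_C_sq_not_dvd_of_deriv_ne_zero P hr1)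
  rwa [Polynomial.C_neg, ← sub_eq_add_neg]

/-- Evaluation of `x₁^k − P(x₀)`. -/
theorem eval_superellipticMv (k : ℕ) (x : Fin 2 → ℂ) :
    MvPolynomial.eval x (X 1 ^ k - Polynomial.aeval (X 0 : MvPolynomial (Fin 2) ℂ) P) =
      x 1 ^ k - P.eval (x 0) := by
  rw [map_sub, map_pow, MvPolynomial.eval_X, eval_polynomial_aeval_X]

/-- `x₁^k − P(x₀)` and its rows. -/
theorem eval_superellipticMv_rows (k : ℕ) (x y : ℂ) :
    MvPolynomial.eval ![x, y] (X 1 ^ k - Polynomial.aeval (X 0 : MvPolynomial (Fin 2) ℂ) P) =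
      ((Polynomial.X ^ k + Polynomial.C (-P)).map (Polynomial.evalRingHom x)).eval y := by
  rw [eval_superellipticMv]
  simp
  ring

/-- `x₁^k − P(x₀)` is irreducible in `ℂ[x₀, x₁]` (`k ≥ 1`, `P` with a simple root). [folklore] -/
theorem irreducible_superellipticMv {k : ℕ} (hk : 1 ≤ k) {r : ℂ} (hr : P.IsRoot r)
    (hr1 : P.derivative.eval r ≠ 0) :
    Irreducible (X 1 ^ k - Polynomial.aeval (X 0 : MvPolynomial (Fin 2) ℂ) P) :=
  (irreducible_rows_iff (eval_superellipticMv_rows P k)).2 (irreducible_superelliptic_row P hk hr hr1)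

/-! ## Part B. The branch at infinity and density -/

/-- **Constant fibres over `x₁^k = P(x₀)` are dense off the residue class** (`k ≥ 1`, `P` monic of
degree `M ≥ 1` with a simple root, `¬(k ∣ 2M ∧ 2M/k ≡ 2 mod 4)`, `θ ≠ 0`): the branch at infinity
is `x₀ = s^{-k}`, `x₁ = U₀(s)^{1/k}s^{-M}` with `P(s^{-k}) = U₀(s)s^{-kM}`, `U₀(0) = 1`, direction `1`.
[cite: MantovaMasser2023, §1 Further remarks, p. 5 (the question, open in general)] (new) -/
theorem unprojectedDense_superelliptic_constFibre {k : ℕ} (hk : 1 ≤ k) (hP : P.Monic)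
    (hM : 1 ≤ P.natDegree) {r : ℂ} (hr : P.IsRoot r) (hr1 : P.derivative.eval r ≠ 0)
    (hres : ¬ (k ∣ 2 * P.natDegree ∧ (2 * P.natDegree / k) % 4 = 2)) {θ : ℂ} (hθ : θ ≠ 0) :
    UnprojectedDense {w : Fin 2 ⊕ Fin 2 → ℂ |
      MvPolynomial.eval ![w (Sum.inl 0), w (Sum.inl 1)]
          (X 1 ^ k - Polynomial.aeval (X 0 : MvPolynomial (Fin 2) ℂ) P) = 0 ∧
      w (Sum.inr 0) = MvPolynomial.eval ![w (Sum.inl 0), w (Sum.inl 1)]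
        (MvPolynomial.C θ : MvPolynomial (Fin 2) ℂ)} := by
  set M := P.natDegree with hMdef
  have hS := isIrreducibleClosed_curveGraphFibre (MvPolynomial.C θ : MvPolynomial (Fin 2) ℂ)
    (irreducible_superellipticMv P hk hr hr1)
  have hdim := zariskiDim_curveGraphFibre (MvPolynomial.C θ : MvPolynomial (Fin 2) ℂ)
    (irreducible_superellipticMv P hk hr hr1)
  obtain ⟨q, hqan, hq0, hqk⟩ := kthRoot_branch_facts hk
  obtain ⟨U₀, hUan, hU0, hUeval⟩ :=
    exists_polarForm_eval P (U := fun _ : ℂ => (1 : ℂ)) analyticAt_const hk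
  rw [one_pow, mul_one, hP.leadingCoeff] at hU0
  -- `x₀ = s^{-k}`, `x₁ = q(U₀(s) − 1) s^{-M}`, `y₀ = θ`
  have hvan : AnalyticAt ℂ (fun s => U₀ s - 1) 0 := hUan.sub analyticAt_const
  have hv0 : U₀ 0 - 1 = 0 := by rw [hU0, sub_self]
  set Φ : ℂ → ℂ := fun s => q (U₀ s - 1) with hΦ
  have hΦan : AnalyticAt ℂ Φ 0 := hqan.comp_of_eq hvan hv0
  have hΦ0 : Φ 0 = 1 := by
    simp only [hΦ, hU0, sub_self]
    exact hq0
  have hψan : AnalyticAt ℂ (fun _ : ℂ => θ) 0 := analyticAt_const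
  have hqk' : ∀ᶠ s in 𝓝 (0 : ℂ), q (U₀ s - 1) ^ k = 1 + (U₀ s - 1) := by
    have h := hvan.continuousAt.tendsto
    rw [hv0] at h
    exact h.eventually hqk
  have hgerm : ∀ᶠ s in 𝓝[≠] (0 : ℂ),
      (Sum.elim ![(s ^ k)⁻¹, Φ s * (s ^ M)⁻¹]
          ![(fun _ : ℂ => θ) s, Complex.exp (Φ s * (s ^ M)⁻¹)] : Fin 2 ⊕ Fin 2 → ℂ) ∈
        {w : Fin 2 ⊕ Fin 2 → ℂ |
          MvPolynomial.eval ![w (Sum.inl 0), w (Sum.inl 1)]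
              (X 1 ^ k - Polynomial.aeval (X 0 : MvPolynomial (Fin 2) ℂ) P) = 0 ∧
          w (Sum.inr 0) = MvPolynomial.eval ![w (Sum.inl 0), w (Sum.inl 1)]
            (MvPolynomial.C θ : MvPolynomial (Fin 2) ℂ)} := by
    filter_upwards [self_mem_nhdsWithin, nhdsWithin_le_nhds hqk'] with s (hs : s ≠ 0) hqs
    refine ⟨?_, ?_⟩
    · simp only [Sum.elim_inl, Matrix.cons_val_zero, Matrix.cons_val_one]
      rw [eval_superellipticMv]
      simp only [Matrix.cons_val_zero, Matrix.cons_val_one, hΦ]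
      have hU := hUeval s hs
      simp only [one_mul, inv_pow] at hU
      rw [mul_pow, hqs, hU, inv_pow, ← pow_mul, Nat.mul_comm M k,
        show (1 : ℂ) + (U₀ s - 1) = U₀ s by ring, sub_self]
    · simp only [Sum.elim_inr, Matrix.cons_val_zero, MvPolynomial.eval_C]
  obtain ⟨z, hz, hzre⟩ := exists_direction_powerCurve hk hres (M := M)
  exact unprojectedDense_branch_growth_of_exists_direction hS (le_of_eq hdim) hk hM hψan hθ rfl
    hΦan ⟨z, hz, by rw [hΦ0, one_mul]; exact hzre⟩ hgerm

/-! ## Part C. The case certificate, and case ∧ dense -/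

/-- **The constant-fibre cylinder over `x₁^k = P(x₀)` is in Mantova–Masser's case** (`k ≥ 2`,
`P` with a simple root — so `P ≠ 0` —, `θ ≠ 0`): were all points of the curve on a line
`m₀x₀ + m₁x₁ = c₀`, either `m₁ = 0` (the points over `x₀ = 0, 1` give `m₀ = 0`) or the action
`x₁ ↦ ωx₁` (`ω = e^{2πi/k} ≠ 1`) gives `x₁ = 0` on the curve, i.e. `P ≡ 0`. (new) -/
theorem mmCase_superelliptic_constFibre {k : ℕ} (hk : 2 ≤ k) {r : ℂ} (hr : P.IsRoot r)
    (hr1 : P.derivative.eval r ≠ 0) {θ : ℂ} (hθ : θ ≠ 0) :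
    MMCaseDimPiOneFree {w : Fin 2 ⊕ Fin 2 → ℂ |
      MvPolynomial.eval ![w (Sum.inl 0), w (Sum.inl 1)]
          (X 1 ^ k - Polynomial.aeval (X 0 : MvPolynomial (Fin 2) ℂ) P) = 0 ∧
      w (Sum.inr 0) = MvPolynomial.eval ![w (Sum.inl 0), w (Sum.inl 1)]
        (MvPolynomial.C θ : MvPolynomial (Fin 2) ℂ)} := by
  have hk0 : k ≠ 0 := by omega
  have hP0 : P ≠ 0 := by
    rintro rfl
    simp at hr1
  refine mmCase_curveGraphFibre (irreducible_superellipticMv P (by omega) hr hr1) ?_ ?_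
  · obtain ⟨y, hy⟩ := IsAlgClosed.exists_pow_nat_eq (P.eval 0) (by omega : 0 < k)
    exact ⟨![0, y], by rw [eval_superellipticMv]; simp [hy], by rw [MvPolynomial.eval_C]; exact hθ⟩
  · intro m hm c₀
    by_contra hall
    push Not at hall
    have hpt : ∀ x y : ℂ, y ^ k = P.eval x → (m 0 : ℂ) * x + (m 1 : ℂ) * y = c₀ := by
      intro x y hy
      have := hall ![x, y] (by rw [eval_superellipticMv]; simp [hy])
      simpa using this
    by_cases hm1 : (m 1 : ℂ) = 0
    · have hm0 : (m 0 : ℂ) ≠ 0 := by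
        intro h0
        apply hm
        funext i
        fin_cases i
        · exact_mod_cast h0
        · exact_mod_cast hm1
      obtain ⟨y₀, hy₀⟩ := IsAlgClosed.exists_pow_nat_eq (P.eval 0) (by omega : 0 < k)
      obtain ⟨y₁, hy₁⟩ := IsAlgClosed.exists_pow_nat_eq (P.eval 1) (by omega : 0 < k)
      have h0 := hpt 0 y₀ hy₀
      have h1 := hpt 1 y₁ hy₁
      rw [hm1] at h0 h1
      apply hm0
      linear_combination h1 - h0
    · -- the `μ_k`-action forces `P ≡ 0`
      have hω := Complex.isPrimitiveRoot_exp k hk0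
      set ω : ℂ := Complex.exp (2 * Real.pi * I / k) with hωdef
      have hωk : ω ^ k = 1 := hω.pow_eq_one
      have hω1 : ω ≠ 1 := hω.ne_one (by omega)
      have hzero : ∀ x : ℂ, P.eval x = 0 := by
        intro x
        obtain ⟨y, hy⟩ := IsAlgClosed.exists_pow_nat_eq (P.eval x) (by omega : 0 < k)
        have hy1 := hpt x y hy
        have hy2 := hpt x (ω * y) (by rw [mul_pow, hωk, one_mul]; exact hy)
        have hy0 : y = 0 := by
          have h2 : (m 1 : ℂ) * (y * (1 - ω)) = 0 := by linear_combination hy1 - hy2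
          rcases mul_eq_zero.1 h2 with h | h
          · exact absurd h hm1
          · rcases mul_eq_zero.1 h with h' | h'
            · exact h'
            · exact absurd (by linear_combination -h') hω1
        rw [← hy, hy0, zero_pow hk0]
      exact hP0 (Polynomial.funext (by simpa using hzero))

/-- **Mantova–Masser's question for constant fibres over the superelliptic curves
`x₁^k = P(x₀)`: case ∧ dense** (`k ≥ 2`; `P` monic of degree `M ≥ 1` with a simple root;
`¬(k ∣ 2M ∧ 2M/k ≡ 2 mod 4)`; `θ ≠ 0`). [cite: MantovaMasser2023, §1 Further remarks, p. 5 (the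
question, open in general)] (new) -/
theorem unprojectedDensityQuestion_superelliptic_constFibre {k : ℕ} (hk : 2 ≤ k) (hP : P.Monic)
    (hM : 1 ≤ P.natDegree) {r : ℂ} (hr : P.IsRoot r) (hr1 : P.derivative.eval r ≠ 0)
    (hres : ¬ (k ∣ 2 * P.natDegree ∧ (2 * P.natDegree / k) % 4 = 2)) {θ : ℂ} (hθ : θ ≠ 0) :
    MMCaseDimPiOneFree {w : Fin 2 ⊕ Fin 2 → ℂ |
        MvPolynomial.eval ![w (Sum.inl 0), w (Sum.inl 1)]
            (X 1 ^ k - Polynomial.aeval (X 0 : MvPolynomial (Fin 2) ℂ) P) = 0 ∧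
        w (Sum.inr 0) = MvPolynomial.eval ![w (Sum.inl 0), w (Sum.inl 1)]
          (MvPolynomial.C θ : MvPolynomial (Fin 2) ℂ)} ∧
      UnprojectedDense {w : Fin 2 ⊕ Fin 2 → ℂ |
        MvPolynomial.eval ![w (Sum.inl 0), w (Sum.inl 1)]
            (X 1 ^ k - Polynomial.aeval (X 0 : MvPolynomial (Fin 2) ℂ) P) = 0 ∧
        w (Sum.inr 0) = MvPolynomial.eval ![w (Sum.inl 0), w (Sum.inl 1)]
          (MvPolynomial.C θ : MvPolynomial (Fin 2) ℂ)} :=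
  ⟨mmCase_superelliptic_constFibre P hk hr hr1 hθ,
    unprojectedDense_superelliptic_constFibre P (by omega) hP hM hr hr1 hres hθ⟩

/-- **Plain coordinates**: `{x₁^k − P(x₀) = 0, y₀ = θ}` is in the case AND dense (hypotheses as
above). [cite: MantovaMasser2023, §1 Further remarks, p. 5 (the question, open in general)] (new) -/
theorem unprojectedDensityQuestion_superelliptic_constFibre' {k : ℕ} (hk : 2 ≤ k) (hP : P.Monic)
    (hM : 1 ≤ P.natDegree) {r : ℂ} (hr : P.IsRoot r) (hr1 : P.derivative.eval r ≠ 0)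
    (hres : ¬ (k ∣ 2 * P.natDegree ∧ (2 * P.natDegree / k) % 4 = 2)) {θ : ℂ} (hθ : θ ≠ 0) :
    MMCaseDimPiOneFree {w : Fin 2 ⊕ Fin 2 → ℂ |
        w (Sum.inl 1) ^ k - P.eval (w (Sum.inl 0)) = 0 ∧ w (Sum.inr 0) = θ} ∧
      UnprojectedDense {w : Fin 2 ⊕ Fin 2 → ℂ |
        w (Sum.inl 1) ^ k - P.eval (w (Sum.inl 0)) = 0 ∧ w (Sum.inr 0) = θ} := by
  have e : {w : Fin 2 ⊕ Fin 2 → ℂ |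
        MvPolynomial.eval ![w (Sum.inl 0), w (Sum.inl 1)]
            (X 1 ^ k - Polynomial.aeval (X 0 : MvPolynomial (Fin 2) ℂ) P) = 0 ∧
        w (Sum.inr 0) = MvPolynomial.eval ![w (Sum.inl 0), w (Sum.inl 1)]
          (MvPolynomial.C θ : MvPolynomial (Fin 2) ℂ)} =
      {w : Fin 2 ⊕ Fin 2 → ℂ |
        w (Sum.inl 1) ^ k - P.eval (w (Sum.inl 0)) = 0 ∧ w (Sum.inr 0) = θ} := by
    ext w
    simp only [Set.mem_setOf_eq, eval_superellipticMv, MvPolynomial.eval_C, Matrix.cons_val_zero,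
      Matrix.cons_val_one]
  have h := unprojectedDensityQuestion_superelliptic_constFibre P hk hP hM hr hr1 hres hθ
  rw [e] at h
  exact h

/-- **Hyperelliptic curves of odd degree** (every genus): for `P` monic of ODD degree with a simple
root and every `θ ≠ 0`, `{x₁² − P(x₀) = 0, y₀ = θ}` is in the case AND dense.
[cite: MantovaMasser2023, §1 Further remarks, p. 5 (the question, open in general)] (new) -/
theorem unprojectedDensityQuestion_hyperellipticOdd_constFibre (hP : P.Monic)
    (hodd : Odd P.natDegree) {r : ℂ} (hr : P.IsRoot r) (hr1 : P.derivative.eval r ≠ 0) {θ : ℂ}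
    (hθ : θ ≠ 0) :
    MMCaseDimPiOneFree {w : Fin 2 ⊕ Fin 2 → ℂ |
        w (Sum.inl 1) ^ 2 - P.eval (w (Sum.inl 0)) = 0 ∧ w (Sum.inr 0) = θ} ∧
      UnprojectedDense {w : Fin 2 ⊕ Fin 2 → ℂ |
        w (Sum.inl 1) ^ 2 - P.eval (w (Sum.inl 0)) = 0 ∧ w (Sum.inr 0) = θ} := by
  obtain ⟨j, hj⟩ := hodd
  refine unprojectedDensityQuestion_superelliptic_constFibre' P (le_refl 2) hP (by omega) hr hr1
    ?_ hθ
  rintro ⟨-, h4⟩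
  rw [hj, Nat.mul_div_cancel_left _ (by norm_num : 0 < 2)] at h4
  omega

end Superelliptic

end Summit.Schanuel.Schanuel.Theorems

end
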